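import Mathlib

/-!
# Dyadic homogeneity: a linear small-gap law on one shell propagates to the ball

Supporting measure theory for the level-statistics (assumption LLA(ν, C₀), eq. (1.5)) analysis of
the three-spin block of
[cite: ImbrieJSP2016, eq. (1.1), assumption LLA(ν, C)]  Repair cell b2b-imbrie, LLA.md block Q7,
step (Q7.1) HOMOGENEITY, in abstract form.
J. Z. Imbrie, *On many-body localization for quantum spin chains*,
J. Stat. Phys. 163 (2016) 998–1048, arXiv:1403.7837 (Theorem 1.1, Assumption LLA).

Setting: `E` a nontrivial finite-dimensional real normed space with an additive Haar measure `μ`,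
and a family of sets `A ε ⊆ E` (think `A ε = {p : gap (H p) < ε}` for a matrix family `H`
homogeneous of degree one in the parameter `p`, so that the gap function `g` satisfies
`g (c • p) = c * g p` for `c > 0`).  The only structure used is the SCALING RULE
`c • A ε = A (c * ε)` (`c > 0`) and a LINEAR LAW ON THE SHELL `S₀ = {1/2 < ‖x‖ ≤ 1}`:
`μ (A ε ∩ S₀) ≤ C * ε`.  Conclusion (`dyadic_homogeneity`): on the punctured unit ball
`μ (A ε ∩ {0 < ‖x‖ ≤ 1}) ≤ C * (1 - (1/2)^(d-1))⁻¹ * ε`, `d = finrank ℝ E`, by decomposing the ball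
into the dyadic shells `(1/2)^k • S₀`, rescaling each to `S₀` (Haar scaling `r ^ d`, law at `ε / r`)
and summing the geometric series `∑ (1/2)^{k(d-1)}`.  `gapSet_scaling` records that sub-level sets of
a degree-one positively homogeneous function obey the scaling rule.

No spectral theory is formalised here; this is the measure-theoretic skeleton of the reduction
'(L_box) ⟸ local linear laws on the unit sphere'.
-/

namespace Literature.MathematicalPhysics.QuantumLattice.Imbrie2016.DyadicHomogeneity

open MeasureTheory Set
open scoped ENNReal Pointwise

variable {E : Type*} [NormedAddCommGroup E] [NormedSpace ℝ E]

/-- [cite: ImbrieJSP2016, eq. (1.1)] The dyadic shell of index `k`: `(1/2)^(k+1) < ‖x‖ ≤ (1/2)^k`. -/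
def shell (k : ℕ) : Set E := {x : E | (1/2 : ℝ) ^ (k + 1) < ‖x‖ ∧ ‖x‖ ≤ (1/2 : ℝ) ^ k}

omit [NormedSpace ℝ E] in
/-- [cite: ImbrieJSP2016, eq. (1.1)] The punctured closed unit ball is covered by the dyadic shells. -/
theorem puncturedBall_subset_iUnion_shell :
    {x : E | 0 < ‖x‖ ∧ ‖x‖ ≤ 1} ⊆ ⋃ k : ℕ, shell k := by
  intro x hx
  obtain ⟨h0, h1⟩ := hx
  obtain ⟨n, hn1, hn2⟩ := exists_nat_pow_near_of_lt_one h0 h1 (by norm_num : (0:ℝ) < 1/2)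
    (by norm_num : (1/2 : ℝ) < 1)
  exact mem_iUnion.mpr ⟨n, hn1, hn2⟩

/-- [cite: ImbrieJSP2016, eq. (1.1)] The `k`-th shell is the `(1/2)^k`-dilate of the `0`-th shell. -/
theorem shell_eq_smul (k : ℕ) :
    (shell k : Set E) = ((1/2 : ℝ) ^ k) • (shell 0 : Set E) := by
  have hr : (0 : ℝ) < (1/2 : ℝ) ^ k := by positivity
  ext x
  rw [mem_smul_set_iff_inv_smul_mem₀ hr.ne']
  simp only [shell, mem_setOf_eq, norm_smul, norm_inv, Real.norm_eq_abs, abs_of_pos hr,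
    pow_zero, zero_add, pow_one]
  constructor
  · rintro ⟨h1, h2⟩
    constructor
    · -- 1/2 < r⁻¹ ‖x‖
      rw [lt_inv_mul_iff₀ hr]
      calc (1/2 : ℝ) ^ k * (1/2) = (1/2 : ℝ) ^ (k + 1) := by ring
        _ < ‖x‖ := h1
    · rw [inv_mul_le_iff₀ hr]; simpa using h2
  · rintro ⟨h1, h2⟩
    constructor
    · rw [lt_inv_mul_iff₀ hr] at h1
      calc (1/2 : ℝ) ^ (k + 1) = (1/2 : ℝ) ^ k * (1/2) := by ring
        _ < ‖x‖ := h1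
    · rw [inv_mul_le_iff₀ hr] at h2; simpa using h2

variable [FiniteDimensional ℝ E] [MeasurableSpace E] [BorelSpace E]

/-- [cite: ImbrieJSP2016, eq. (1.1), assumption LLA(ν, C)] DYADIC HOMOGENEITY.  If the sets `A ε`
obey the scaling rule `c • A ε = A (c * ε)` for `c > 0` and the linear law `μ (A ε ∩ S₀) ≤ C ε` on
the shell `S₀ = {1/2 < ‖x‖ ≤ 1}`, then on the punctured unit ball
`μ (A ε ∩ {0 < ‖x‖ ≤ 1}) ≤ C (1 - (1/2)^(d-1))⁻¹ ε`, `d = finrank ℝ E`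
(for `d = 1` the constant is `∞` and the statement is void, as it must be). -/
theorem dyadic_homogeneity [Nontrivial E] (μ : Measure E) [μ.IsAddHaarMeasure]
    (A : ℝ → Set E) (C : ℝ≥0∞)
    (hscale : ∀ c ε : ℝ, 0 < c → c • A ε = A (c * ε))
    (hshell : ∀ ε : ℝ, 0 < ε → μ (A ε ∩ shell 0) ≤ C * ENNReal.ofReal ε) :
    ∀ ε : ℝ, 0 < ε →
      μ (A ε ∩ {x : E | 0 < ‖x‖ ∧ ‖x‖ ≤ 1})
        ≤ C * (1 - ENNReal.ofReal ((1/2 : ℝ) ^ (Module.finrank ℝ E - 1)))⁻¹ * ENNReal.ofReal ε := by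
  intro ε hε
  set d := Module.finrank ℝ E with hd
  have hd1 : 1 ≤ d := Module.finrank_pos
  set ρ : ℝ≥0∞ := ENNReal.ofReal ((1/2 : ℝ) ^ (d - 1)) with hρ
  -- per-shell bound
  have hk : ∀ k : ℕ, μ (A ε ∩ shell k) ≤ C * ENNReal.ofReal ε * ρ ^ k := by
    intro k
    set r : ℝ := (1/2 : ℝ) ^ k with hr_def
    have hr : 0 < r := by positivity
    have hAr : A ε = r • A (ε / r) := by
      rw [hscale r (ε / r) hr]; congr 1; field_simp
    have hset : A ε ∩ shell k = r • (A (ε / r) ∩ shell 0) := by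
      rw [smul_set_inter₀ hr.ne', ← hAr, ← shell_eq_smul]
    rw [hset, Measure.addHaar_smul_of_nonneg μ hr.le]
    have hlaw := hshell (ε / r) (div_pos hε hr)
    calc ENNReal.ofReal (r ^ d) * μ (A (ε / r) ∩ shell 0)
        ≤ ENNReal.ofReal (r ^ d) * (C * ENNReal.ofReal (ε / r)) := by gcongr
      _ = C * (ENNReal.ofReal (r ^ d) * ENNReal.ofReal (ε / r)) := by ring
      _ = C * ENNReal.ofReal (r ^ d * (ε / r)) := by
          rw [ENNReal.ofReal_mul (by positivity)]
      _ = C * ENNReal.ofReal (ε * r ^ (d - 1)) := by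
          congr 2
          obtain ⟨m, hm⟩ : ∃ m, d = m + 1 := ⟨d - 1, by omega⟩
          rw [hm, Nat.add_sub_cancel, pow_succ]; field_simp
      _ = C * ENNReal.ofReal ε * ρ ^ k := by
          rw [ENNReal.ofReal_mul hε.le, hρ, ← ENNReal.ofReal_pow (by positivity), ← pow_mul,
            ← pow_mul, mul_comm k (d - 1), mul_assoc]
  -- sum over shells
  calc μ (A ε ∩ {x : E | 0 < ‖x‖ ∧ ‖x‖ ≤ 1})
      ≤ μ (⋃ k : ℕ, A ε ∩ shell k) := by
        apply measure_mono
        intro x hx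
        obtain ⟨hA, hB⟩ := hx
        obtain ⟨k, hk'⟩ := mem_iUnion.mp (puncturedBall_subset_iUnion_shell hB)
        exact mem_iUnion.mpr ⟨k, hA, hk'⟩
    _ ≤ ∑' k : ℕ, μ (A ε ∩ shell k) := measure_iUnion_le _
    _ ≤ ∑' k : ℕ, C * ENNReal.ofReal ε * ρ ^ k := ENNReal.tsum_le_tsum hk
    _ = C * ENNReal.ofReal ε * ∑' k : ℕ, ρ ^ k := ENNReal.tsum_mul_left
    _ = C * ENNReal.ofReal ε * (1 - ρ)⁻¹ := by rw [ENNReal.tsum_geometric]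
    _ = C * (1 - ρ)⁻¹ * ENNReal.ofReal ε := by ring

omit [FiniteDimensional ℝ E] [MeasurableSpace E] [BorelSpace E] in
/-- [cite: ImbrieJSP2016, eq. (1.1)] Sub-level sets of a positively homogeneous function of degree
one obey the scaling rule used in `dyadic_homogeneity`: `c • {g < ε} = {g < c ε}` for `c > 0`. -/
theorem gapSet_scaling (g : E → ℝ) (hg : ∀ (c : ℝ) (x : E), 0 < c → g (c • x) = c * g x)
    (c ε : ℝ) (hc : 0 < c) :
    c • {x : E | g x < ε} = {x : E | g x < c * ε} := by
  ext x
  rw [mem_smul_set_iff_inv_smul_mem₀ hc.ne']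
  simp only [mem_setOf_eq]
  rw [hg c⁻¹ x (inv_pos.mpr hc)]
  constructor
  · intro h
    have := mul_lt_mul_of_pos_left h hc
    rwa [← mul_assoc, mul_inv_cancel₀ hc.ne', one_mul] at this
  · intro h
    have := mul_lt_mul_of_pos_left h (inv_pos.mpr hc)
    rwa [← mul_assoc, inv_mul_cancel₀ hc.ne', one_mul] at this

/-- [cite: ImbrieJSP2016, eq. (1.1), assumption LLA(ν, C)] Corollary for a degree-one positively
homogeneous 'gap function' `g`: a linear law for `{g < ε}` on the shell gives a linear law on the
punctured unit ball. -/
theorem dyadic_homogeneity_of_homogeneous [Nontrivial E] (μ : Measure E) [μ.IsAddHaarMeasure]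
    (g : E → ℝ) (hg : ∀ (c : ℝ) (x : E), 0 < c → g (c • x) = c * g x) (C : ℝ≥0∞)
    (hshell : ∀ ε : ℝ, 0 < ε → μ ({x : E | g x < ε} ∩ shell 0) ≤ C * ENNReal.ofReal ε) :
    ∀ ε : ℝ, 0 < ε →
      μ ({x : E | g x < ε} ∩ {x : E | 0 < ‖x‖ ∧ ‖x‖ ≤ 1})
        ≤ C * (1 - ENNReal.ofReal ((1/2 : ℝ) ^ (Module.finrank ℝ E - 1)))⁻¹ * ENNReal.ofReal ε :=
  dyadic_homogeneity μ (fun ε => {x : E | g x < ε}) C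
    (fun c ε hc => gapSet_scaling g hg c ε hc) hshell

end Literature.MathematicalPhysics.QuantumLattice.Imbrie2016.DyadicHomogeneity
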